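import Summits.Langlands.Langlands.Theorems.NonParallelVoidTensorSquareParallelStubTensorInductionPDIndexTwo
import Literature.NumberTheory.GaloisRepresentations.FramedGaloisRepInduce
import Literature.NumberTheory.GaloisRepresentations.AbsIntegersEquiv
import HarnessLib

/-!
# Tensor induction along an index-two subgroup, II: `⊗-Ind_{Γ_F}^{Γ_K} ρ` as a framed Galois
# representation; its character on `Γ_F`; unramified almost everywhere

Helper file 2/3 of stub `stub_tensorInductionPD` (crux `NonParallelVoid.TensorSquareParallel`,
stmt-Langlands-17009, line `merged`); registered sub-goal `stub_tensorInductionPD_tensorInduce`.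

For a quadratic Galois extension `F/K` of fields of characteristic `0` (`h2 : [F : K] = 2`) the image
`res(Γ_F) ≤ Γ_K` of the tree's `absGaloisRestrict K F` has index two
(`index_range_absGaloisRestrict_eq_two`).  We CHOOSE `τ ∈ Γ_K ∖ res(Γ_F)` (`tiTau`) and `t ∈ Γ_F`
with `res t = τ²` (`tiSq`), put `θ = absGaloisOuterConj K F τ` (`tiTheta`; `res (θ σ) = τ res(σ) τ⁻¹`,
`θ² = Int(t)`, `θ t = t`), and define the **tensor induction** of a framed `ρ : Γ_F →ₜ* GL_n(A)`:
`tiMatrixHom K F h2 ρ : Γ_K →* M_{n × n}(A)`, the index-two extension (file 1, `indexTwoExtendHom`)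
of `σ ↦ ρ(σ) ⊗ₖ ρ(θ σ)` by `τ ↦ T = (1 ⊗ₖ ρ t) S` (`x ⊗ y ↦ y ⊗ ρ(t) x`), and
`tensorInduce K F h2 e ρ : FramedGaloisRep K A m`, the same relabelled along
`e : Fin n × Fin n ≃ Fin m` and continuous (`continuous_indexTwoExtend`: entries are polynomials in
the entries of the extension by zero `ρ̇`, continuous as `res` is an open embedding).

Main results (all proved): `tiMatrixHom_absGaloisRestrict` (`Ψ(res σ) = ρ σ ⊗ ρ θσ`),
`trace_tensorInduce_absGaloisRestrict_eq` (**(T0)**: `tr Ψ(res σ) = tr ρ(σ) tr ρ(σ')` whenever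
`res σ' = τ' res σ τ'⁻¹`, for ANY `τ' ∉ res(Γ_F)`), `trace_tensorInduce_of_not_mem_of_mul_self`
(`tr Ψ(g) = n` for an involution `g ∉ res(Γ_F)`: `Ψ(g)` is the swap up to `ρ(σ θσ t) = ρ(1)`),
`eventually_isUnramifiedAt_tensorInduce` (**(T1)**: `Ψ` is unramified at every `v` whose inertia
groups lie in `res(Γ_F)` — all but finitely many, `eventually_forall_inertia_le_range_absGaloisRestrict`
— and above which `ρ` and `ρ^τ` are unramified; `isUnramifiedAt_outerConj_iff`, `AbsIntegersEquiv`).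
The form, the multiplier and the packaged statement over `ℚ` ((T2), (T5)) are in file 3/3.
The choices `τ`, `t`, `K̄ ≅ F̄` change `Ψ` by conjugation only; the exported statements are
conjugation invariant or carry their own form.

References: C. W. Curtis, I. Reiner, *Methods of Representation Theory* I (1981), §13 (tensor
induction); J.-P. Serre, *Linear representations of finite groups*, §7.2, §8.1; F. Calegari, *Even
Galois representations and the Fontaine–Mazur conjecture*, Invent. Math. 185 (2011), §2; J.-P. Serre,
*Abelian ℓ-adic representations* (1968), Ch. I §2.1.
-/

noncomputable section

set_option linter.dupNamespace false  -- `Summit.Langlands.Langlands.…` is the mandated summit-side namespace (D-0022)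

open Matrix Topology Field
open scoped Kronecker

namespace Summit.Langlands.Langlands.Theorems.TensorSquareParallel

open Literature.NumberTheory.GaloisRepresentations


/-! ### Index two: `res(Γ_F) ≤ Γ_K` for a quadratic extension, the chosen `τ` and `t` -/

section GaloisIndexTwo

universe u v

variable (K : Type u) (F : Type v) [Field K] [Field F] [Algebra K F] [CharZero K]
  [FiniteDimensional K F]

open scoped NumberField

/-- `[Γ_K : res(Γ_F)] = 2` for a quadratic extension `F/K`. [folklore] -/
theorem index_range_absGaloisRestrict_eq_two (h2 : Module.finrank K F = 2) :
    (absGaloisRestrict K F).range.index = 2 :=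
  (nat_card_quotient_range_absGaloisRestrict K F).trans h2

/-- There is `τ ∈ Γ_K ∖ res(Γ_F)`. [folklore] -/
theorem exists_not_mem_range_absGaloisRestrict (h2 : Module.finrank K F = 2) :
    ∃ τ : absoluteGaloisGroup K, τ ∉ (absGaloisRestrict K F).range := by
  by_contra! h
  have htop : (absGaloisRestrict K F).range = ⊤ := (Subgroup.eq_top_iff' _).2 h
  have hi := index_range_absGaloisRestrict_eq_two K F h2
  rw [htop, Subgroup.index_top] at hi
  exact absurd hi (by norm_num)

/-- **A chosen `τ ∈ Γ_K ∖ res(Γ_F)`** (the nontrivial coset of the quadratic extension). [folklore] -/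
def tiTau (h2 : Module.finrank K F = 2) : absoluteGaloisGroup K :=
  Classical.choose (exists_not_mem_range_absGaloisRestrict K F h2)

/-- `τ ∉ res(Γ_F)`. [folklore] -/
theorem tiTau_not_mem (h2 : Module.finrank K F = 2) : tiTau K F h2 ∉ (absGaloisRestrict K F).range :=
  Classical.choose_spec (exists_not_mem_range_absGaloisRestrict K F h2)

/-- `τ² ∈ res(Γ_F)`. [folklore] -/
theorem tiTau_mul_tiTau_mem (h2 : Module.finrank K F = 2) :
    tiTau K F h2 * tiTau K F h2 ∈ (absGaloisRestrict K F).range :=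
  Subgroup.mul_self_mem_of_index_two (index_range_absGaloisRestrict_eq_two K F h2) _

/-- **The chosen `t ∈ Γ_F` with `res t = τ²`.** [folklore] -/
def tiSq (h2 : Module.finrank K F = 2) : absoluteGaloisGroup F :=
  Classical.choose (tiTau_mul_tiTau_mem K F h2)

/-- `res t = τ²`. [folklore] -/
theorem absGaloisRestrict_tiSq (h2 : Module.finrank K F = 2) :
    absGaloisRestrict K F (tiSq K F h2) = tiTau K F h2 * tiTau K F h2 :=
  Classical.choose_spec (tiTau_mul_tiTau_mem K F h2)

/-- `g ∉ res(Γ_F) ⟹ g τ⁻¹ ∈ res(Γ_F)` (two cosets). [folklore] -/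
theorem mul_tiTau_inv_mem (h2 : Module.finrank K F = 2) {g : absoluteGaloisGroup K}
    (hg : g ∉ (absGaloisRestrict K F).range) : g * (tiTau K F h2)⁻¹ ∈ (absGaloisRestrict K F).range := by
  rw [Subgroup.mul_mem_iff_of_index_two (index_range_absGaloisRestrict_eq_two K F h2), inv_mem_iff]
  exact iff_of_false hg (tiTau_not_mem K F h2)

/-- `τ⁻¹ τ' ∈ res(Γ_F)` for any other `τ' ∉ res(Γ_F)`. [folklore] -/
theorem tiTau_inv_mul_mem (h2 : Module.finrank K F = 2) {τ' : absoluteGaloisGroup K}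
    (hτ' : τ' ∉ (absGaloisRestrict K F).range) : (tiTau K F h2)⁻¹ * τ' ∈ (absGaloisRestrict K F).range := by
  rw [Subgroup.mul_mem_iff_of_index_two (index_range_absGaloisRestrict_eq_two K F h2), inv_mem_iff]
  exact iff_of_false (tiTau_not_mem K F h2) hτ'

variable [IsGalois K F] [CharZero F]

/-- **`θ = θ_τ : Γ_F → Γ_F`**, `res (θ σ) = τ res(σ) τ⁻¹` (`absGaloisOuterConj`). [folklore] -/
abbrev tiTheta (h2 : Module.finrank K F = 2) : absoluteGaloisGroup F →ₜ* absoluteGaloisGroup F :=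
  absGaloisOuterConj K F (tiTau K F h2)

/-- `t σ = θ(θ σ) t`. [folklore] -/
theorem tiSq_mul (h2 : Module.finrank K F = 2) (σ : absoluteGaloisGroup F) :
    tiSq K F h2 * σ = tiTheta K F h2 (tiTheta K F h2 σ) * tiSq K F h2 := by
  apply absGaloisRestrict_injective K F
  simp only [map_mul, absGaloisRestrict_absGaloisOuterConj, absGaloisRestrict_tiSq]
  group

/-- `θ t = t`. [folklore] -/
theorem tiTheta_tiSq (h2 : Module.finrank K F = 2) : tiTheta K F h2 (tiSq K F h2) = tiSq K F h2 := by
  apply absGaloisRestrict_injective K F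
  simp only [absGaloisRestrict_absGaloisOuterConj, absGaloisRestrict_tiSq]
  group

/-- `θ (θ σ) = t σ t⁻¹`. [folklore] -/
theorem tiTheta_tiTheta_apply (h2 : Module.finrank K F = 2) (σ : absoluteGaloisGroup F) :
    tiTheta K F h2 (tiTheta K F h2 σ) = tiSq K F h2 * σ * (tiSq K F h2)⁻¹ := by
  rw [tiSq_mul, mul_inv_cancel_right]

/-- For `g = res(σ) τ` with `g² = 1`: `σ · θ(σ) · t = 1`. [folklore] -/
theorem mul_tiTheta_mul_tiSq_eq_one (h2 : Module.finrank K F = 2) {σ : absoluteGaloisGroup F}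
    (hg : (absGaloisRestrict K F σ * tiTau K F h2) * (absGaloisRestrict K F σ * tiTau K F h2) = 1) :
    σ * (tiTheta K F h2 σ * tiSq K F h2) = 1 := by
  apply absGaloisRestrict_injective K F
  simp only [map_mul, map_one, absGaloisRestrict_absGaloisOuterConj, absGaloisRestrict_tiSq]
  rw [← hg]
  group

end GaloisIndexTwo

/-! ### The tensor induction `⊗-Ind_{Γ_F}^{Γ_K} ρ` of a framed Galois representation -/

section TensorInduce

universe u v

variable (K : Type u) (F : Type v) [Field K] [Field F] [Algebra K F] [CharZero K]
  [FiniteDimensional K F] [IsGalois K F] [CharZero F]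
  {A : Type*} [CommRing A] [TopologicalSpace A] [IsTopologicalRing A] {n m : ℕ}

/-- `D(σ) = ρ(σ) ⊗ ρ(θ σ)`, the restriction of the tensor induction to `Γ_F` (matrix form on
`Fin n × Fin n`). [folklore] -/
abbrev tiPair (h2 : Module.finrank K F = 2) (ρ : FramedGaloisRep F A n) :
    absoluteGaloisGroup F →* Matrix (Fin n × Fin n) (Fin n × Fin n) A :=
  kroneckerPairHom (FramedRep.toMatrixHom ρ)
    ((FramedRep.toMatrixHom ρ).comp (tiTheta K F h2).toMonoidHom)

/-- **The tensor induction, matrix form on `Fin n × Fin n`**: the index-two extension of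
`σ ↦ ρ(σ) ⊗ ρ(θ σ)` by `τ ↦ (1 ⊗ ρ t) S`.
Ref: Curtis–Reiner, *Methods of representation theory* I, §13; Calegari 2011, §2. [folklore] -/
def tiMatrixHom (h2 : Module.finrank K F = 2) (ρ : FramedGaloisRep F A n) :
    absoluteGaloisGroup K →* Matrix (Fin n × Fin n) (Fin n × Fin n) A :=
  indexTwoExtendHom (φ := (absGaloisRestrict K F).toMonoidHom) (absGaloisRestrict_injective K F)
    (tiPair K F h2 ρ) (tiTau_not_mem K F h2)
    (tensorTwist (FramedRep.toMatrixHom ρ) (tiSq K F h2))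
    (θ := (tiTheta K F h2).toMonoidHom) (fun σ => absGaloisRestrict_absGaloisOuterConj K F _ σ)
    (t := tiSq K F h2) (absGaloisRestrict_tiSq K F h2)
    (fun σ => tensorTwist_mul_kroneckerPairHom _ _ _ (tiSq_mul K F h2) σ)
    (tensorTwist_mul_tensorTwist _ _ _ (tiTheta_tiSq K F h2))
    (fun _ hg => mul_tiTau_inv_mem K F h2 hg)

omit [IsTopologicalRing A] in
/-- `Ψ(res σ) = ρ(σ) ⊗ ρ(θ σ)`. [folklore] -/
theorem tiMatrixHom_absGaloisRestrict (h2 : Module.finrank K F = 2) (ρ : FramedGaloisRep F A n)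
    (σ : absoluteGaloisGroup F) :
    tiMatrixHom K F h2 ρ (absGaloisRestrict K F σ) =
      ((ρ σ : GL (Fin n) A) : Matrix (Fin n) (Fin n) A) ⊗ₖ
        ((ρ (tiTheta K F h2 σ) : GL (Fin n) A) : Matrix (Fin n) (Fin n) A) :=
  indexTwoExtend_apply_map (absGaloisRestrict_injective K F) _ (tiTau_not_mem K F h2) _ σ

omit [IsTopologicalRing A] in
/-- `Ψ(res(σ) τ) = (ρ(σ) ⊗ ρ(θ σ)) T`. [folklore] -/
theorem tiMatrixHom_absGaloisRestrict_mul_tiTau (h2 : Module.finrank K F = 2)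
    (ρ : FramedGaloisRep F A n) (σ : absoluteGaloisGroup F) :
    tiMatrixHom K F h2 ρ (absGaloisRestrict K F σ * tiTau K F h2) =
      ((ρ σ : GL (Fin n) A) : Matrix (Fin n) (Fin n) A) ⊗ₖ
        ((ρ (tiTheta K F h2 σ) : GL (Fin n) A) : Matrix (Fin n) (Fin n) A) *
        tensorTwist (FramedRep.toMatrixHom ρ) (tiSq K F h2) :=
  indexTwoExtend_apply_map_mul (absGaloisRestrict_injective K F) _ (tiTau_not_mem K F h2) _ σ

/-- `Ψ` is continuous. [folklore] -/
theorem continuous_tiMatrixHom (h2 : Module.finrank K F = 2) (ρ : FramedGaloisRep F A n) :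
    Continuous (tiMatrixHom K F h2 ρ) := by
  have hD : Continuous (tiPair K F h2 ρ) := by
    refine continuous_matrix fun a b => ?_
    exact ((FramedRep.continuous_toMatrixHom ρ).matrix_elem a.1 b.1).mul
      (((FramedRep.continuous_toMatrixHom ρ).comp (tiTheta K F h2).continuous).matrix_elem a.2 b.2)
  exact continuous_indexTwoExtend (isOpenEmbedding_absGaloisRestrict K F) hD _ _

/-- The flattened matrix form `Γ_K →* M_m(A)` along `e : Fin n × Fin n ≃ Fin m`. [folklore] -/
def tiFlatHom (h2 : Module.finrank K F = 2) (e : Fin n × Fin n ≃ Fin m) (ρ : FramedGaloisRep F A n) :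
    absoluteGaloisGroup K →* Matrix (Fin m) (Fin m) A :=
  (Matrix.reindexRingEquiv A e).toRingHom.toMonoidHom.comp (tiMatrixHom K F h2 ρ)

omit [IsTopologicalRing A] in
/-- Unfolding lemma for `tiFlatHom`. [folklore] -/
@[simp] theorem tiFlatHom_apply (h2 : Module.finrank K F = 2) (e : Fin n × Fin n ≃ Fin m)
    (ρ : FramedGaloisRep F A n) (g : absoluteGaloisGroup K) :
    tiFlatHom K F h2 e ρ g = Matrix.reindex e e (tiMatrixHom K F h2 ρ g) := rfl

/-- The flattened matrix form is continuous. [folklore] -/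
theorem continuous_tiFlatHom (h2 : Module.finrank K F = 2) (e : Fin n × Fin n ≃ Fin m)
    (ρ : FramedGaloisRep F A n) : Continuous (tiFlatHom K F h2 e ρ) := by
  change Continuous fun g => Matrix.reindex e e (tiMatrixHom K F h2 ρ g)
  exact (continuous_tiMatrixHom K F h2 ρ).matrix_submatrix _ _

/-- **The tensor induction `⊗-Ind_{Γ_F}^{Γ_K} ρ : Γ_K →ₜ* GL_m(A)`** of a framed Galois representation
`ρ : Γ_F →ₜ* GL_n(A)` along a quadratic Galois extension `F/K` (`h2 : [F : K] = 2`), on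
`Aⁿ ⊗ Aⁿ` relabelled by `e : Fin n × Fin n ≃ Fin m`: with the chosen `τ ∈ Γ_K ∖ res(Γ_F)`,
`θ = θ_τ` and `t = res⁻¹(τ²)`, it is `res(σ) ↦ ρ(σ) ⊗ ρ(θ σ)` and `τ ↦ (x ⊗ y ↦ y ⊗ ρ(t) x)`.
Continuous (the entries are polynomials in the entries of `ρ̇`), well defined up to conjugation.
Ref: Curtis–Reiner, *Methods of representation theory* I, §13 (tensor induction); F. Calegari,
*Even Galois representations and the Fontaine–Mazur conjecture*, §2. [folklore] -/
def tensorInduce (h2 : Module.finrank K F = 2) (e : Fin n × Fin n ≃ Fin m) (ρ : FramedGaloisRep F A n) :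
    FramedGaloisRep K A m where
  toMonoidHom := (tiFlatHom K F h2 e ρ).toHomUnits
  continuous_toFun := by
    refine Units.continuous_iff.2 ⟨?_, ?_⟩
    · exact continuous_tiFlatHom K F h2 e ρ
    · exact (continuous_tiFlatHom K F h2 e ρ).comp continuous_inv

/-- The matrix of `(⊗-Ind ρ)(g)` is the relabelled `Ψ(g)`. [folklore] -/
@[simp] theorem tensorInduce_apply_coe (h2 : Module.finrank K F = 2) (e : Fin n × Fin n ≃ Fin m)
    (ρ : FramedGaloisRep F A n) (g : absoluteGaloisGroup K) :
    ((tensorInduce K F h2 e ρ g : GL (Fin m) A) : Matrix (Fin m) (Fin m) A) =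
      Matrix.reindex e e (tiMatrixHom K F h2 ρ g) := rfl

/-- **`tr (⊗-Ind ρ)(res σ) = tr ρ(σ) · tr ρ(θ σ)`.** [folklore] -/
theorem trace_tensorInduce_absGaloisRestrict (h2 : Module.finrank K F = 2) (e : Fin n × Fin n ≃ Fin m)
    (ρ : FramedGaloisRep F A n) (σ : absoluteGaloisGroup F) :
    FramedRep.trace (tensorInduce K F h2 e ρ) (absGaloisRestrict K F σ) =
      FramedRep.trace ρ σ * FramedRep.trace ρ (tiTheta K F h2 σ) := by
  rw [FramedRep.trace, tensorInduce_apply_coe, trace_reindex, tiMatrixHom_absGaloisRestrict,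
    trace_kronecker]
  rfl

/-- **The character of `⊗-Ind ρ` on `Γ_F`, intrinsic form**: for EVERY `τ' ∈ Γ_K ∖ res(Γ_F)` and
`σ, σ' ∈ Γ_F` with `res σ' = τ' res(σ) τ'⁻¹`, `tr (⊗-Ind ρ)(res σ) = tr ρ(σ) · tr ρ(σ')` (the
conjugates by two elements of the nontrivial coset differ by an inner automorphism of `Γ_F`).
Ref: Curtis–Reiner, *Methods of representation theory* I, §13. [folklore] -/
theorem trace_tensorInduce_absGaloisRestrict_eq (h2 : Module.finrank K F = 2)
    (e : Fin n × Fin n ≃ Fin m) (ρ : FramedGaloisRep F A n) {τ' : absoluteGaloisGroup K}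
    (hτ' : τ' ∉ (absGaloisRestrict K F).range) (σ σ' : absoluteGaloisGroup F)
    (hσ' : absGaloisRestrict K F σ' = τ' * absGaloisRestrict K F σ * τ'⁻¹) :
    FramedRep.trace (tensorInduce K F h2 e ρ) (absGaloisRestrict K F σ) =
      FramedRep.trace ρ σ * FramedRep.trace ρ σ' := by
  rw [trace_tensorInduce_absGaloisRestrict]
  congr 1
  obtain ⟨u, hu⟩ := tiTau_inv_mul_mem K F h2 hτ'
  have hτ'eq : τ' = tiTau K F h2 * absGaloisRestrict K F u := by
    rw [show absGaloisRestrict K F u = (tiTau K F h2)⁻¹ * τ' from hu, mul_inv_cancel_left]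
  have hσ'θ : σ' = absGaloisOuterConj K F τ' σ :=
    absGaloisRestrict_injective K F (by rw [absGaloisRestrict_absGaloisOuterConj, hσ'])
  rw [hσ'θ, hτ'eq, absGaloisOuterConj_mul_apply, absGaloisOuterConj_absGaloisRestrict_apply, map_mul,
    map_mul, map_inv, trace_conj_eq_trace]

/-- `(⊗-Ind ρ)(res σ) = 1` when `ρ(σ) = 1` and `ρ(θ σ) = 1`. [folklore] -/
theorem tensorInduce_absGaloisRestrict_eq_one (h2 : Module.finrank K F = 2) (e : Fin n × Fin n ≃ Fin m)
    (ρ : FramedGaloisRep F A n) {σ : absoluteGaloisGroup F} (h1 : ρ σ = 1)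
    (h1' : ρ (tiTheta K F h2 σ) = 1) : tensorInduce K F h2 e ρ (absGaloisRestrict K F σ) = 1 := by
  refine Units.ext ?_
  rw [tensorInduce_apply_coe, tiMatrixHom_absGaloisRestrict, h1, h1', Units.val_one, one_kronecker_one,
    Units.val_one, Matrix.reindex_apply]
  exact Matrix.submatrix_one_equiv e.symm

/-- **`tr (⊗-Ind ρ)(g) = n` for an involution `g ∈ Γ_K ∖ res(Γ_F)`** (e.g. a complex conjugation when
`F` is totally complex): `(⊗-Ind ρ)(g)` is the swap `x ⊗ y ↦ y ⊗ x` up to `ρ` of the trivial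
element `σ θ(σ) t = 1`. Ref: Calegari 2011, §2. [folklore] -/
theorem trace_tensorInduce_of_not_mem_of_mul_self (h2 : Module.finrank K F = 2)
    (e : Fin n × Fin n ≃ Fin m) (ρ : FramedGaloisRep F A n) {g : absoluteGaloisGroup K}
    (hg : g ∉ (absGaloisRestrict K F).range) (hgg : g * g = 1) :
    FramedRep.trace (tensorInduce K F h2 e ρ) g = n := by
  obtain ⟨σ, hσ⟩ := mul_tiTau_inv_mem K F h2 hg
  have hgeq : g = absGaloisRestrict K F σ * tiTau K F h2 := by
    rw [show absGaloisRestrict K F σ = g * (tiTau K F h2)⁻¹ from hσ, inv_mul_cancel_right]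
  rw [hgeq] at hgg ⊢
  rw [FramedRep.trace, tensorInduce_apply_coe, trace_reindex, tiMatrixHom_absGaloisRestrict_mul_tiTau,
    kronecker_mul_tensorTwist, trace_kronecker_mul_swapMatrix]
  change ((FramedRep.toMatrixHom ρ σ) * (FramedRep.toMatrixHom ρ (tiTheta K F h2 σ) *
    FramedRep.toMatrixHom ρ (tiSq K F h2))).trace = _
  rw [← map_mul, ← map_mul, mul_tiTheta_mul_tiSq_eq_one K F h2 hgg, map_one, Matrix.trace_one,
    Fintype.card_fin]

end TensorInduce

/-! ### Unramified almost everywhere -/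

section Unramified

universe u v

open scoped NumberField
open IsDedekindDomain

variable (K : Type u) (F : Type v) [Field K] [NumberField K] [Field F] [NumberField F] [Algebra K F]
  [FiniteDimensional K F] [IsGalois K F]
  {A : Type*} [CommRing A] [TopologicalSpace A] [IsTopologicalRing A] {n m : ℕ}

/-- **`⊗-Ind ρ` is unramified at all but finitely many places** when `ρ` is: at a place `v` of `K`
with all inertia above `v` inside `res(Γ_F)` and with `ρ`, `ρ^τ` unramified at every `w ∣ v`,
`(⊗-Ind ρ)(I_𝔓) = {ρ(a) ⊗ ρ(θ a)} = 1`.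
Ref: Serre, *Abelian ℓ-adic representations* (1968), Ch. I §2.1. [folklore] -/
theorem eventually_isUnramifiedAt_tensorInduce (h2 : Module.finrank K F = 2) (e : Fin n × Fin n ≃ Fin m)
    (ρ : FramedGaloisRep F A n)
    (hρ : ∀ᶠ w : HeightOneSpectrum (𝓞 F) in Filter.cofinite, ρ.IsUnramifiedAt w) :
    ∀ᶠ v : HeightOneSpectrum (𝓞 K) in Filter.cofinite, (tensorInduce K F h2 e ρ).IsUnramifiedAt v := by
  have hρ' : ∀ᶠ w : HeightOneSpectrum (𝓞 F) in Filter.cofinite,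
      (ρ.outerConj (tiTau K F h2)).IsUnramifiedAt w := by
    simp only [FramedGaloisRep.isUnramifiedAt_outerConj_iff]
    rw [Filter.eventually_cofinite] at hρ ⊢
    exact hρ.preimage (MulAction.injective (absGaloisQuot K F (tiTau K F h2))).injOn
  have hboth : ∀ᶠ v : HeightOneSpectrum (𝓞 K) in Filter.cofinite, ∀ w : HeightOneSpectrum (𝓞 F),
      w.asIdeal.under (𝓞 K) = v.asIdeal →
        ρ.IsUnramifiedAt w ∧ (ρ.outerConj (tiTau K F h2)).IsUnramifiedAt w := by
    have hw := hρ.and hρ'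
    rw [Filter.eventually_cofinite] at hw ⊢
    refine (hw.image fun w => w.under (𝓞 K)).subset fun v hv => ?_
    simp only [Set.mem_setOf_eq, not_forall] at hv
    obtain ⟨w, hw', hbad⟩ := hv
    exact ⟨w, hbad, HeightOneSpectrum.ext hw'⟩
  filter_upwards [eventually_forall_inertia_le_range_absGaloisRestrict K F, hboth] with v hvI hvρ
  intro 𝔓 h𝔓 g hg
  obtain ⟨a, ha⟩ := hvI 𝔓 h𝔓 hg
  haveI : 𝔓.IsPrime := h𝔓.1
  set 𝔔 : Ideal (absIntegers (𝓞 F) F) :=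
    𝔓.comap ((absIntegersEquiv K F).symm : absIntegers (𝓞 F) F →+* absIntegers (𝓞 K) K) with h𝔔
  have h𝔔c : 𝔔.comap (absIntegersMap K F) = 𝔓 := by
    rw [h𝔔, ← coe_absIntegersEquiv]
    exact Ideal.comap_of_equiv _
  haveI : 𝔔.IsPrime := Ideal.comap_isPrime _ _
  have h𝔔v : 𝔔.comap (absIntegersMap K F) ∈ v.primesAbove := by
    rw [h𝔔c]
    exact h𝔓
  obtain ⟨w, hw, h𝔔w, -⟩ := exists_heightOneSpectrum_of_comap_absIntegersMap_mem_primesAbove h𝔔v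
  have haI : a ∈ 𝔔.inertia (absoluteGaloisGroup F) := by
    rw [← comap_inertia_comap_absIntegersMap K F 𝔔, Subgroup.mem_comap, h𝔔c]
    change absGaloisRestrict K F a ∈ _
    rw [show absGaloisRestrict K F a = g from ha]
    exact hg
  obtain ⟨h1, h1'⟩ := hvρ w hw
  rw [← show absGaloisRestrict K F a = g from ha]
  exact tensorInduce_absGaloisRestrict_eq_one K F h2 e ρ (h1 𝔔 h𝔔w a haI) (h1' 𝔔 h𝔔w a haI)

end Unramified

/-! ### The registered sub-goal: the tensor induction exists, with (T0), (T1) and the involution trace -/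

section Stub

open scoped NumberField
open IsDedekindDomain

/-- **Registered sub-goal `stub_tensorInductionPD_tensorInduce` of stub `stub_tensorInductionPD`
(crux `TensorSquareParallel`)**: for a quadratic Galois extension `F/K` of number fields and a framed
`ρ : Γ_F →ₜ* GL_n(A)` unramified almost everywhere, the tensor induction
`ψ = ⊗-Ind_{Γ_F}^{Γ_K} ρ : Γ_K →ₜ* GL_{n²}(A)` (`tensorInduce`) has (T0) `tr ψ(res σ) = tr ρ(σ) tr ρ(σ')`
whenever `res σ' = τ res(σ) τ⁻¹` with `τ ∉ res(Γ_F)`, (T1) is unramified almost everywhere, and has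
trace `n` on every involution of `Γ_K` outside `res(Γ_F)`.  Ref: Curtis–Reiner, *Methods of
representation theory* I, §13; F. Calegari, *Even Galois representations and the Fontaine–Mazur
conjecture*, §2. [folklore] -/
theorem stub_tensorInductionPD_tensorInduce : ∀ (K F : Type) [Field K] [NumberField K] [Field F] [NumberField F] [Algebra K F] [FiniteDimensional K F] [IsGalois K F], Module.finrank K F = 2 → ∀ (A : Type) [CommRing A] [TopologicalSpace A] [IsTopologicalRing A] (n : ℕ) (ρ : FramedGaloisRep F A n), (∀ᶠ w : HeightOneSpectrum (𝓞 F) in Filter.cofinite, ρ.IsUnramifiedAt w) → ∃ ψ : FramedGaloisRep K A (n * n), (∀ τ : absoluteGaloisGroup K, τ ∉ Set.range (absGaloisRestrict K F) → ∀ σ σ' : absoluteGaloisGroup F, absGaloisRestrict K F σ' = τ * absGaloisRestrict K F σ * τ⁻¹ → (ψ (absGaloisRestrict K F σ)).val.trace = (ρ σ).val.trace * (ρ σ').val.trace) ∧ (∀ᶠ v : HeightOneSpectrum (𝓞 K) in Filter.cofinite, ψ.IsUnramifiedAt v) ∧ (∀ g : absoluteGaloisGroup K, g ∉ Set.range (absGaloisRestrict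 K F) → g * g = 1 → (ψ g).val.trace = n) := by
  intro K F _ _ _ _ _ _ _ h2 A _ _ _ n ρ hρ
  refine ⟨tensorInduce K F h2 finProdFinEquiv ρ, fun τ hτ σ σ' hσ' => ?_, ?_, fun g hg hgg => ?_⟩
  · exact trace_tensorInduce_absGaloisRestrict_eq K F h2 _ ρ (fun ⟨x, hx⟩ => hτ ⟨x, hx⟩) σ σ' hσ'
  · exact eventually_isUnramifiedAt_tensorInduce K F h2 _ ρ hρ
  · exact trace_tensorInduce_of_not_mem_of_mul_self K F h2 _ ρ (fun ⟨x, hx⟩ => hg ⟨x, hx⟩) hgg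

end Stub

end Summit.Langlands.Langlands.Theorems.TensorSquareParallel

end
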